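import Summits.QuantumFields.YangMills.Theorems.LuscherReductionTwistedTraceScalingBOStiffQuasimodeFrame
import Literature.Analysis.OperatorTheory.GaussianTransferKernel
import HarnessLib

/-!
# (B-ST) (W1-10 (A2)-model) `…BOStiffFlatQuasimode`: THE FLAT MODEL OF THE CENTRAL QUASIMODE — the profile `e^{−Σcᵢyᵢ²}⊗e^{−‖z‖²/s²}` is an EXACT eigenfunction of the flat kernel
# `e^{−Σãᵢxᵢ²}e^{−Σb̃ᵢ(xᵢ−yᵢ)²}e^{−Σãᵢyᵢ²}` (stiff modes, mode-dependent kinetic rates) ⊗ `1` (gauge block), integrated against product Lebesgue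
# (lane A of S-BASE, crux `TwistedTraceScaling` stmt-QuantumFields-20203, C4-CORE, the (B-ST) pen; (A) split (A2); coordinates = the lead's `…BOStiffFlatCoords` (`ã²+2ãb̃ = c²`))

Pure real analysis, no tree objects: for `ãᵢ ≥ 0`, `b̃ᵢ > 0`, `cᵢ ≥ 0`, `cᵢ² = ãᵢ² + 2ãᵢb̃ᵢ` (mode-dependent `b̃ᵢ` — the lead's flat coordinates rescale each mode) and a gauge width `s > 0`:
* ★ `integral_flatKernel_profile_pi` — `∫ Πᵢ[e^{−ãᵢxᵢ²}e^{−b̃ᵢ(xᵢ−yᵢ)²}e^{−ãᵢyᵢ²}e^{−cᵢyᵢ²}] dy = (Πᵢ√(π/(ãᵢ+b̃ᵢ+cᵢ)))·e^{−Σcᵢxᵢ²}` (✓Literature 1-D ground state per mode, product Lebesgue);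
* ★★ `integral_flatKernel_profile_prod` — with the gauge block `Z` (any finite-dimensional real inner product space, volume): 
  `∫_{(y,z)} Πᵢ[…]·e^{−‖z‖²/s²} d(vol⊗vol) = (Πᵢ√(π/(ãᵢ+b̃ᵢ+cᵢ)))·(π s²)^{dim Z/2}·e^{−Σcᵢxᵢ²}` — FLAT in the gauge coordinate of the centre, Gaussian `e^{−Σcᵢxᵢ²}` in the stiff one.
This is the exact identity behind (Q±); the truncation to the profile ball and the dictionary to `cK, cΘ, cW` (✓`…BOStiffFlatCoords`, ✓`…BOStiffActionHessian`, ✓PiDensity) follow.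
HONEST FRAMING: Gaussian algebra for a stub of a child of the CONDITIONAL route R2b1; (Q±) OPEN; (B-ST), C4-CORE OPEN; not infinite volume, not a gap, not Clay.
-/

set_option autoImplicit false

noncomputable section

open MeasureTheory Filter Topology Real
open scoped BigOperators

namespace Summit.QuantumFields.YangMills.Theorems.FemtoTransferGap.TwoLattice.ConstTube

open Literature.Analysis.OperatorTheory.GaussianTransferKernel

/-! ## §1 The stiff block: product of one-mode ground states with mode-dependent kinetic rates -/

/-- ★ **Stiff block**: `∫ Πᵢ[e^{−ãᵢxᵢ²}e^{−b̃ᵢ(xᵢ−yᵢ)²}e^{−ãᵢyᵢ²}e^{−cᵢyᵢ²}] dy = (Πᵢ√(π/(ãᵢ+b̃ᵢ+cᵢ)))·Πᵢe^{−cᵢxᵢ²}`. [cite: Wipf2021, §8.5.1 (8.56)–(8.57)] -/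
theorem integral_flatKernel_profile_pi {ι : Type*} [Fintype ι] {a b c : ι → ℝ} (ha : ∀ i, 0 ≤ a i) (hb : ∀ i, 0 < b i) (hc0 : ∀ i, 0 ≤ c i)
    (hc : ∀ i, c i ^ 2 = a i ^ 2 + 2 * a i * b i) (x : ι → ℝ) :
    ∫ y : ι → ℝ, ∏ i, Real.exp (-(a i * x i ^ 2)) * Real.exp (-(b i * (x i - y i) ^ 2)) * Real.exp (-(a i * y i ^ 2)) * Real.exp (-(c i * y i ^ 2)) =
      (∏ i, Real.sqrt (π / (a i + b i + c i))) * ∏ i, Real.exp (-(c i * x i ^ 2)) := by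
  have h := integral_fintype_prod_volume_eq_prod (𝕜 := ℝ) (E := fun _ : ι => ℝ)
    (fun i (t : ℝ) => Real.exp (-(a i * x i ^ 2)) * Real.exp (-(b i * (x i - t) ^ 2)) * Real.exp (-(a i * t ^ 2)) * Real.exp (-(c i * t ^ 2)))
  rw [h]
  simp_rw [integral_gaussKernel_mul_groundState_real' (ha _) (hb _) (hc0 _) (hc _)]
  rw [Finset.prod_mul_distrib]

/-- The same with the exponentials summed: `Πᵢe^{−cᵢxᵢ²} = e^{−Σcᵢxᵢ²}`. [folklore] -/
theorem prod_exp_neg_eq {ι : Type*} [Fintype ι] (c x : ι → ℝ) : ∏ i, Real.exp (-(c i * x i ^ 2)) = Real.exp (-(∑ i, c i * x i ^ 2)) := by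
  rw [← Finset.sum_neg_distrib, Real.exp_sum]

/-! ## §2 The gauge block and the product -/

section Gauge

variable {Z : Type*} [NormedAddCommGroup Z] [InnerProductSpace ℝ Z] [FiniteDimensional ℝ Z] [MeasurableSpace Z] [BorelSpace Z]

/-- Gauge block: `∫ e^{−‖z‖²/s²} dz = (π s²)^{dim Z/2}` (`s ≠ 0`). [folklore] -/
theorem integral_gauge_gaussian {s : ℝ} (hs : 0 < s) :
    ∫ z : Z, Real.exp (-(‖z‖ ^ 2 / s ^ 2)) = (π * s ^ 2) ^ ((Module.finrank ℝ Z : ℝ) / 2) := by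
  have hb : 0 < 1 / s ^ 2 := by positivity
  have h := GaussianFourier.integral_rexp_neg_mul_sq_norm (V := Z) hb
  have e : (fun z : Z => Real.exp (-(1 / s ^ 2) * ‖z‖ ^ 2)) = fun z => Real.exp (-(‖z‖ ^ 2 / s ^ 2)) := by
    funext z; congr 1; ring
  rw [e] at h
  rw [h]; congr 1; field_simp

/-- ★★ **THE FLAT MODEL IDENTITY** (stiff block ⊗ gauge block, product Lebesgue): for `x : ι → ℝ`,
`∫ (Πᵢ[e^{−ãᵢxᵢ²}e^{−b̃ᵢ(xᵢ−yᵢ)²}e^{−ãᵢyᵢ²}e^{−cᵢyᵢ²}])·e^{−‖z‖²/s²} d(y,z) = (Πᵢ√(π/(ãᵢ+b̃ᵢ+cᵢ)))·(πs²)^{dim Z/2}·e^{−Σcᵢxᵢ²}`. [cite: Wipf2021, §8.5.1 (8.56)–(8.57)] -/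
theorem integral_flatKernel_profile_prod {ι : Type*} [Fintype ι] {a b c : ι → ℝ} (ha : ∀ i, 0 ≤ a i) (hb : ∀ i, 0 < b i) (hc0 : ∀ i, 0 ≤ c i)
    (hc : ∀ i, c i ^ 2 = a i ^ 2 + 2 * a i * b i) {s : ℝ} (hs : 0 < s) (x : ι → ℝ) :
    ∫ p : (ι → ℝ) × Z, (∏ i, Real.exp (-(a i * x i ^ 2)) * Real.exp (-(b i * (x i - p.1 i) ^ 2)) * Real.exp (-(a i * p.1 i ^ 2)) * Real.exp (-(c i * p.1 i ^ 2))) *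
        Real.exp (-(‖p.2‖ ^ 2 / s ^ 2)) ∂((volume : Measure (ι → ℝ)).prod (volume : Measure Z)) =
      (∏ i, Real.sqrt (π / (a i + b i + c i))) * (π * s ^ 2) ^ ((Module.finrank ℝ Z : ℝ) / 2) * Real.exp (-(∑ i, c i * x i ^ 2)) := by
  rw [integral_prod_mul (μ := (volume : Measure (ι → ℝ))) (ν := (volume : Measure Z))
    (f := fun y : ι → ℝ => ∏ i, Real.exp (-(a i * x i ^ 2)) * Real.exp (-(b i * (x i - y i) ^ 2)) * Real.exp (-(a i * y i ^ 2)) * Real.exp (-(c i * y i ^ 2)))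
    (g := fun z : Z => Real.exp (-(‖z‖ ^ 2 / s ^ 2)))]
  rw [integral_flatKernel_profile_pi ha hb hc0 hc x, integral_gauge_gaussian hs, prod_exp_neg_eq]
  ring

end Gauge

end Summit.QuantumFields.YangMills.Theorems.FemtoTransferGap.TwoLattice.ConstTube

end
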